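import Summits.CriticalPhenomena.PercolationContinuityZ3.Theses.PercLowPointHalfSpace
import Summits.CriticalPhenomena.PercolationContinuityZ3.Theorems.TallClusterMassBound.Negative.MassExponentFamily
import Summits.CriticalPhenomena.PercolationContinuityZ3.Theorems.TallClusterMassBound.Negative.FalseWithoutCriticality
import Summits.CriticalPhenomena.PercolationContinuityZ3.Theorems.PercLowPointHalfSpaceTallClusterMassBoundWallArmPartial
import Summits.CriticalPhenomena.PercolationContinuityZ3.Theorems.PercLowPointHalfSpaceTallClusterMassBoundStubMassLeTypicalMaxLog
import Summits.CriticalPhenomena.PercolationContinuityZ3.Theorems.PercLowPointHalfSpaceTallClusterMassBoundStubTightnessArithmetic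
import Summits.CriticalPhenomena.PercolationContinuityZ3.Theorems.PercLowPointHalfSpaceTallClusterMassBoundStubFirstMomentTransfer
import Summits.CriticalPhenomena.PercolationContinuityZ3.Theorems.PercLowPointHalfSpaceTallClusterMassBoundStubKLVolumeTail
import Summits.CriticalPhenomena.PercolationContinuityZ3.Theorems.PercLowPointHalfSpaceTallClusterMassBoundStubCrossoverTransfer
import Summits.CriticalPhenomena.PercolationContinuityZ3.Theorems.PercLowPointHalfSpaceTallClusterMassBoundStubBallTwoPointTransfer
import Summits.CriticalPhenomena.PercolationContinuityZ3.Theorems.PercLowPointHalfSpaceTallClusterMassBoundStubSubharmonicTransfer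
import Summits.CriticalPhenomena.PercolationContinuityZ3.Theorems.PercLowPointHalfSpaceTallClusterMassBoundArrowOneLogRatio
import Summits.CriticalPhenomena.PercolationContinuityZ3.Theorems.PercLowPointHalfSpaceTallClusterMassBoundArrowOneVolRad
import Summits.CriticalPhenomena.PercolationContinuityZ3.Theorems.PercLowPointHalfSpaceTallClusterMassBoundArrowOneLogNecessary
import Summits.CriticalPhenomena.PercolationContinuityZ3.Theorems.PercLowPointHalfSpaceTallClusterMassBoundArrowOneThreshold
import Summits.CriticalPhenomena.PercolationContinuityZ3.Theorems.PercLowPointHalfSpaceTallClusterMassBoundRestatement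
import Summits.CriticalPhenomena.PercolationContinuityZ3.Theorems.PercLowPointHalfSpaceTallClusterMassBoundBypass
import Literature.Probability.Percolation.UniversalTightness
import Literature.Probability.Percolation.HalfSpaceFloorDilution
import Literature.Probability.Percolation.HutchcroftVolumeTail
import Literature.Probability.Percolation.SusceptibilityGammaOne

/-!
# Line `SketchIdeator4` (= crux idea `universal-tightness-volume-tail`) — checked skeleton for crux
# `TallClusterMassBound` (stmt-CriticalPhenomena-0912, route PercLowPointHalfSpace, item B; line leads a2 → c1 → c2 → c3 → c4; state after lead c4, 2026-08-17)

Crux (by name): `Summit.CriticalPhenomena.PercolationContinuityZ3.Theses.PercLowPointHalfSpace.TallClusterMassBound`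
`= MassBoundAt p_c (11/4)` (`Negative.tallClusterMassBound_iff`, `Iff.rfl`):
`M(r) := Σ_{x ∈ B_r} P(0 ↔_ℍ x, arm_ℍ(0,r)) ≤ C r^{11/4} π_s(r)`, `π_s(r) := P(arm_ℍ(0,r))`, at `p_c(ℤ³)`.

IDEA (card `Ideas/universal-tightness-volume-tail.md`, sketch `SketchIdeator4.lean` §3–§3b): Hutchcroft's ROOTED
UNIVERSAL TIGHTNESS (tree `UniversalTightness.lean`, `prodBernoulli_real_clusterCapIn_ge_le_exp_mul`, proved for every
product Bernoulli measure) applied to bond percolation on the INDUCED half-space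
(`PcH := floorDilutedPercolation 3 p_c 1`, a `prodBernoulli`; agrees with `P_{p_c}` on every event determined by the
pairs of points of `ℍ`, `floorDilutedPercolation_one_apply_eq`) with `Λ_r := halfBox r = B_r ∩ ℍ` and root `0`:
`M(r) ≤ E_{PcH}[|K_0 ∩ Λ_r| ; arm_r]` (an `ℍ`-open path is an open path), and the volume `|K_0 ∩ Λ_r|` has an
exponential tail above the typical maximum `M(Λ_r) = typicalMax PcH Λ_r` WHATEVER ONE CONDITIONS ON, so layer cake on
the event `arm_r` (probability `π_s(r) ≥ 1/(588 r²)`, landed `armProb_criticalProbI_ge`) gives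
`M(r) ≤ M(Λ_r) π_s(r) (2 log(1/π_s(r)) + 13) ≤ C M(Λ_r) log r · π_s(r)`. Hence B follows from the one-scale, root-free,
unconditioned residual C⁺ = `HalfBoxTypicalMax(s)`: `M(Λ_r) ≤ C r^s` for SOME `s < 11/4`.

* `stub_massLeTypicalMaxLog` (ARROW 1, probabilistic core; PROVABLE NOW; the lead's): the displayed layer-cake bound
  `∃ K, ∀ r ≥ 1, M(r) ≤ K · M(Λ_r) · π_s(r) · (1 + log(1/π_s(r)))`.
* `stub_tightnessArithmetic` (ARROW 1, arithmetic; PROVABLE NOW): that bound + `M(Λ_r) ≤ C r^s` (`s < 11/4`) +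
  `π_s(r) ≥ 1/(588 r²)` ⇒ `MassBoundAt p_c (11/4)` (`log(1/π_s) ≤ log 588 + 2 log r`, `r^s log r ≤ C_s r^{11/4}`).
* `stub_halfBoxTypicalMax` (C⁺, OPEN — where B's world-separating content now sits; the lead's): `∃ s < 11/4, ∃ C,
  ∀ r ≥ 1, M(Λ_r) ≤ C r^s`. Heuristic truth `s = d_f ≈ 2.523` (MC kit j018191: slopes 2.25–2.83, `E[mass|tall]/M(Λ_r)`
  flat 0.8–1.06); false at `p = 1` (`M(Λ_1 r) = |Λ_r| ≍ r³`): criticality sits entirely here. NOT known to imply the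
  conjunct (BGN shatters `C_∞ ∩ ℍ` into finite pieces; only the BULK typical max is captured by uniqueness).
* ENGINES for C⁺ (registered closed sub-goals; PROVABLE NOW; their INPUTS are open exponent bounds for `ℤ³`):
  `stub_firstMomentTransfer` (ARROW 2: bulk volume tail `P_{p_c}(|C| ≥ n) ≤ C n^{-θ}` ⇒ C⁺ with `s = 3/(1+θ)`;
  `< 11/4 ⟺ θ > 1/11`), `stub_klVolumeTail` (ARROW 3: `χ(p) ≤ C (p_c-p)^{-γ}` ⇒ volume tail `θ = 1 - γ/2`, by the tree's
  KL lemma `real_clusterSizeGe_le_of_kl` + Markov at `ε = n^{-1/2}`; `θ > 1/11 ⟺ γ < 20/11`), `stub_crossoverTransfer`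
  (ARROW 2′: subcritical SURFACE susceptibility profile `Σ_{B_R} P_p((h,0,0) ↔_ℍ x) ≤ C (p_c-p)^{-γ₁} (1+h)^κ` ⇒ C⁺ with
  `s = (3+κ)/(2-γ₁/2)`; `< 11/4 ⟺ 11γ₁ + 8κ < 20`; this input is NOT known to close the summit), `stub_halfBoxTwoPointTransfer`
  (ENGINE 4, lead c2, p117888: the TWO-POINT FORM of C⁺ — `T(r) := Σ_{x,y ∈ Λ_r} P_{p_c}(x ↔_ℍ y) ≤ C r^t` ⇒ C⁺ with `s = t/2`;
  `< 11/4 ⟺ t < 11/2`; with the two-sided comparison `(M-1)²/e ≤ T(r) ≤ 108 r³ M` landed in the same file, so C⁺ and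
  HalfBoxTwoPointSum are ONE open problem; bulk parent `Σ_{B_R} τ_{p_c} ≤ C R^{3-a}`, `a > 1/2`, = route PercTwoPointDecay's target
  stmt-0833 at level `a > 1/2`), `stub_subharmonicTransfer` (ENGINE 4″, lead c2, p118651: sub-mean-value of `τ_p^s` off `Λ_R` for all
  `p < p_c` — PercSubharmonicSquare's crux K1 at a FIXED exponent `s` — ⇒ `τ_{p_c}(0,x) ≤ C‖x‖^{-1/s}` by the exterior maximum principle
  against the lattice Green function (b = 1) + left-continuity; `s < 2` ⇒ B; `s = 2` = stmt-11506 `SquareSubharmonic` VERBATIM ⇒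
  `MassBoundAt p_c m` for every `m > 11/4`, i.e. B up to ARROW 1's `log r`). The bulk inputs are quantitative `θ(p_c) = 0` statements
  (calibration of the lever, not the line's stub); the subharmonic ones are EXISTING cruxes of another route (11505 pinned / 11506 verbatim).
* `TallClusterMassBound_of` (PROVED from `stub_massLeTypicalMaxLog`, `stub_tightnessArithmetic`, `stub_halfBoxTypicalMax`):
  the ONLY theorem of this file concluding the crux by name. The engine compositions conclude `MassBoundAt p_c (11/4)`.

DISPROOF USED (`Cruxes/TallClusterMassBound/Disproof.lean`, cdisprove gen 1, NO KILL; `-- Targets`: none):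
`tallClusterMassBound_false_without_criticality` (¬`MassBoundAt 1 (11/4)`) — honoured: ARROW 1 holds at EVERY `p` (pure
tightness + layer cake), and at `p = 1` C⁺ is false (`M(Λ_r) = |Λ_r|`), so the split localises criticality in the one open
stub; `not_densityBoundAt_criticalProbI` — everything is averaged (the typical max is a `1/e`-quantile, the engines are first
moments over `Λ_r`); `succ_mul_armProb_le_mass` (`m ≥ 1`) consistent with `M(Λ_r) ≥ 2`; `massBoundAt_three` is the `θ = 0`
endpoint of ARROW 2; Disproof §8.4(c) (wall-arm regularity) is used NOWHERE in this line — the stub on which all three dead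
lines broke is deleted by tightness; §4b's open shadow `E|U ∩ B_r| ≤ C r^{11/4}` also falls to C⁺ (`E|K_max| ≤ 4M`, tree).
Negatives index (`ledger negatives`, per Findings-ideator4 §6): nothing on volume tails / typical max / susceptibility shapes.
-/

noncomputable section

open MeasureTheory Finset Filter
open Literature.Probability.Percolation Literature.Probability.LatticeModels
open Summit.CriticalPhenomena.PercolationContinuityZ3.Theses.PercLowPointHalfSpace (TallClusterMassBound)
open Summit.CriticalPhenomena.PercolationContinuityZ3.Theorems.TallClusterMassBound.Negative
open Summit.CriticalPhenomena.PercolationContinuityZ3.Theorems.TallClusterMassBound.ReplicaOverlap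
  (armProb_criticalProbI_ge)

namespace Summit.CriticalPhenomena.PercolationContinuityZ3.Cruxes.TallClusterMassBound.TightnessLine

/-! ## Vocabulary of the line

Landed, importable (`Theorems/TallClusterMassBound/Negative/MassExponentFamily.lean`, `…/FalseWithoutCriticality.lean`):
`V3 = Site 3`, `Hs = {x | 0 ≤ x 0}`, `Pp p = bondPercolation (zdGraph 3) p`, `conn x = openConnIn Hs 0 x`,
`arm r` (verbatim the route's tall event), `armProb p r = (Pp p).real (arm r)`,
`mass p r = Σ_{x ∈ box 3 r} (Pp p).real (conn x ∩ arm r)`, `MassBoundAt p s`, `up h = (h,0,0)`,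
`halfBox r = (box 3 r).filter (0 ≤ · 0)`. Literature: `typicalMax μ Λ` (UniversalTightness.lean),
`floorDilutedPercolation 3 p 1` (bond percolation on the induced half-space, HalfSpaceFloorDilution.lean),
`clusterSizeGe x n` (MeanFieldBetaFromGamma.lean), `chi 3 p` (SusceptibilityGammaOne.lean). No new definition. -/

/-! ## The registered stubs -/

/-- **STUB 1a (ARROW 1, probabilistic core; the lead's) — conditional mass ≤ typical max × log.**
At `p_c(ℤ³)`, for every `r ≥ 1`: `M(r) ≤ K · M(Λ_r) · π_s(r) · (1 + log(1/π_s(r)))` where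
`M(Λ_r) = typicalMax PcH (halfBox r)`, `PcH = floorDilutedPercolation 3 p_c 1`. Proof plan: `P_{p_c} = PcH` on `conn x ∩ arm r`
and on `arm r` (determined by `ℍ`-pairs); `M(r) ≤ E_{PcH}[|K_0 ∩ Λ_r| ; arm_r]` surely; layer cake
`E[X;A] = Σ_{n=1}^{|Λ|} P(X ≥ n, A) ≤ T·P(A) + Σ_{n>T} e^{3/2} e^{-n/(2M)}` (rooted tightness with `α = n/M`), `T = ⌈2M log(1/P(A))⌉ ∨ M`,
geometric tail `≤ e^{3/2}(1+2M) e^{-T/(2M)} ≤ e^{3/2}(1+2M) P(A)`; `M ≥ 2`. LANDED (lead, p111432, 369 lines, proved at EVERY `p`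
with `K = 2 + 3e^{3/2}`): `Theorems/PercLowPointHalfSpaceTallClusterMassBoundStubMassLeTypicalMaxLog.lean`. -/
theorem stub_massLeTypicalMaxLog :
    ∃ K : ℝ, ∀ r : ℕ, 1 ≤ r →
      mass (criticalProbI 3) r ≤
        K * (typicalMax (floorDilutedPercolation 3 (criticalProbI 3) 1) (halfBox r) : ℝ) *
          armProb (criticalProbI 3) r * (1 + Real.log (1 / armProb (criticalProbI 3) r)) :=
  Summit.CriticalPhenomena.PercolationContinuityZ3.Theorems.TallClusterMassBound.TightnessLine.stub_massLeTypicalMaxLog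

/-- **STUB 1b (ARROW 1, arithmetic) — from the log bound and C⁺ to `MassBoundAt p_c (11/4)`.**
Inputs: the bound of stub 1a with constant `K`, a typical-max bound `M(Λ_r) ≤ C r^s` with `s < 11/4`, and the landed floor
`π_s(r) ≥ 1/(588 r²)` (`armProb_criticalProbI_ge`), whence `log(1/π_s(r)) ≤ log 588 + 2 log r` and
`r^s (1 + log 588 + 2 log r) ≤ C_s r^{11/4}` (`Real.log_le_rpow_div`). LANDED (wave 1, W1, p111474, 124 lines):
`Theorems/PercLowPointHalfSpaceTallClusterMassBoundStubTightnessArithmetic.lean`. -/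
theorem stub_tightnessArithmetic :
    ∀ (K s C : ℝ), s < (11 : ℝ) / 4 →
      (∀ r : ℕ, 1 ≤ r →
        mass (criticalProbI 3) r ≤
          K * (typicalMax (floorDilutedPercolation 3 (criticalProbI 3) 1) (halfBox r) : ℝ) *
            armProb (criticalProbI 3) r * (1 + Real.log (1 / armProb (criticalProbI 3) r))) →
      (∀ r : ℕ, 1 ≤ r →
        (typicalMax (floorDilutedPercolation 3 (criticalProbI 3) 1) (halfBox r) : ℝ) ≤ C * (r : ℝ) ^ s) →
      MassBoundAt (criticalProbI 3) ((11 : ℝ) / 4) :=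
  Summit.CriticalPhenomena.PercolationContinuityZ3.Theorems.TallClusterMassBound.TightnessLine.stub_tightnessArithmetic

/-- **STUB 2 (C⁺, OPEN; the lead's) — sub-volume typical maximum of the induced half-space percolation in the
half-box at `p_c(ℤ³)`:** `∃ s < 11/4, ∃ C, ∀ r ≥ 1, typicalMax PcH (halfBox r) ≤ C r^s`. Heuristic truth `s = d_f ≈ 2.52`;
jump world: unknown (pieces of `C_∞ ∩ ℍ` are finite by BGN, but no sub-volume bound on them follows); false at `p = 1`.
Engines: stubs 3, 4, 5 (inputs open). Size: XL (open; crux-sized). -/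
theorem stub_halfBoxTypicalMax :
    ∃ s : ℝ, s < (11 : ℝ) / 4 ∧ ∃ C : ℝ, ∀ r : ℕ, 1 ≤ r →
      (typicalMax (floorDilutedPercolation 3 (criticalProbI 3) 1) (halfBox r) : ℝ) ≤ C * (r : ℝ) ^ s := by
  sorry

/-- **STUB 3 (ARROW 2, ENGINE; provable now) — first moment for the maximum.** A bulk critical volume tail
`P_{p_c}(|C(0)| ≥ n) ≤ C n^{-θ}` (`0 < θ ≤ 1`) gives `typicalMax PcH (halfBox r) ≤ C' r^{3/(1+θ)}`: on `{|K_max(Λ)| ≥ n}` at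
least `n` vertices `v ∈ Λ` have `|K_v ∩ Λ| ≥ n`, so `P(|K_max| ≥ n) ≤ (1/n) Σ_{v ∈ Λ} PcH(|K_v ∩ Λ| ≥ n)` (Markov on the count);
`{|K_v ∩ Λ| ≥ n} ⊆ clusterSizeGe v n`; `PcH ≤ P_{p_c}` on increasing events (weights `floorDilutedParam ≤ p_c·𝟙_{edge}`,
`prodBernoulli_mono_of_isUpperSet`); translation invariance of `P_{p_c}`; `|Λ_r| ≤ 27 r³`; then `typicalMax ≤ n` as soon as
`27 C r³ n^{-(1+θ)} ≤ e^{-1}` (`Nat.sInf_le`). LANDED (wave 1, W2, p111509, 165 lines):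
`Theorems/PercLowPointHalfSpaceTallClusterMassBoundStubFirstMomentTransfer.lean`. -/
theorem stub_firstMomentTransfer :
    ∀ (θ C : ℝ), 0 < θ → θ ≤ 1 →
      (∀ n : ℕ, 1 ≤ n → (Pp (criticalProbI 3)).real (clusterSizeGe (0 : V3) n) ≤ C * (n : ℝ) ^ (-θ)) →
      ∃ C' : ℝ, ∀ r : ℕ, 1 ≤ r →
        (typicalMax (floorDilutedPercolation 3 (criticalProbI 3) 1) (halfBox r) : ℝ) ≤
          C' * (r : ℝ) ^ (3 / (1 + θ)) :=
  Summit.CriticalPhenomena.PercolationContinuityZ3.Theorems.TallClusterMassBound.TightnessLine.stub_firstMomentTransfer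

/-- **STUB 4 (ARROW 3, ENGINE; provable now) — KL volume tail from a subcritical susceptibility bound.**
`χ(p) ≤ C (p_c - p)^{-γ}` for all `p < p_c` (`1 ≤ γ < 2`) gives `P_{p_c}(|C(0)| ≥ n) ≤ C' n^{-(1-γ/2)}`: the tree's KL lemma
`real_clusterSizeGe_le_of_kl` (`Δ = 6`, `degree_zdGraph_le`) at `q = p_c`, `p = p_c - ε`:
`P_{p_c}(|C| ≥ n) ≤ 2 P_p(|C| ≥ n) + 48 kl(p‖p_c) Σ_{j ≤ n} P_p(|C| ≥ j) ≤ (2/n + 48 kl) χ(p)` (Markov and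
`ofReal_sum_real_clusterSizeGe_le` + `expClusterSize_eq_ofReal_chi`), `kl(p‖q) ≤ (q-p)²/(q(1-q))`, `ε = n^{-1/2}`;
`0 < p_c(ℤ³) < 1` (`Grimmett1999_criticalProb_pos_lt_one_holds`). LANDED (wave 1, W3, p111492, 161 lines):
`Theorems/PercLowPointHalfSpaceTallClusterMassBoundStubKLVolumeTail.lean`. -/
theorem stub_klVolumeTail :
    ∀ (γ C : ℝ), 1 ≤ γ → γ < 2 →
      (∀ p : unitInterval, (p : ℝ) < criticalProb (zdGraph 3) (0 : V3) →
        chi 3 p ≤ C * (criticalProb (zdGraph 3) (0 : V3) - (p : ℝ)) ^ (-γ)) →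
      ∃ C' : ℝ, ∀ n : ℕ, 1 ≤ n →
        (Pp (criticalProbI 3)).real (clusterSizeGe (0 : V3) n) ≤ C' * (n : ℝ) ^ (-(1 - γ / 2)) :=
  Summit.CriticalPhenomena.PercolationContinuityZ3.Theorems.TallClusterMassBound.TightnessLine.stub_klVolumeTail

/-- **STUB 5 (ARROW 2′, ENGINE; provable now) — surface crossover transfer.** A subcritical surface susceptibility
profile bound `Σ_{x ∈ B_R} P_p((h,0,0) ↔_ℍ x) ≤ C (p_c - p)^{-γ₁} (1+h)^κ` (all `p < p_c`, `h`, `R`; `1 ≤ γ₁ < 2`, `0 ≤ κ`) gives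
`typicalMax PcH (halfBox r) ≤ C' r^{(3+κ)/(2-γ₁/2)}`: KL lemma `real_clusterSizeGe_le_of_kl` on the INDUCED half-space graph
(degree ≤ 6) rooted at `v ∈ Λ_r`, `E_p|K^ℍ_v| = sup_R Σ_{B_R} P_p(v ↔_ℍ x)` (lateral translation to `up (v 0)`), Markov at
`ε = n^{-1/2}`: `PcH(|K^ℍ_v| ≥ n) ≤ C n^{-(1-γ₁/2)} (1 + v 0)^κ`; first moment over `Λ_r` with `Σ_{v ∈ Λ_r} (1+v₀)^κ ≤ C r^{3+κ}`.
LANDED (wave 1, W4): helper `floorDiluted_real_clusterSizeGe_le_of_surfaceProfile` p111116 (278 lines,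
`Theorems/PercLowPointHalfSpaceTallClusterMassBoundStubCrossoverHalfSpaceKL.lean`) + main p112625 (175 lines,
`Theorems/PercLowPointHalfSpaceTallClusterMassBoundStubCrossoverTransfer.lean`). -/
theorem stub_crossoverTransfer :
    ∀ (γ₁ κ C : ℝ), 1 ≤ γ₁ → γ₁ < 2 → 0 ≤ κ →
      (∀ p : unitInterval, (p : ℝ) < criticalProb (zdGraph 3) (0 : V3) → ∀ h R : ℕ,
        ∑ x ∈ box 3 R, (Pp p).real (openConnIn Hs (up h) x) ≤
          C * (criticalProb (zdGraph 3) (0 : V3) - (p : ℝ)) ^ (-γ₁) * ((h : ℝ) + 1) ^ κ) →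
      ∃ C' : ℝ, ∀ r : ℕ, 1 ≤ r →
        (typicalMax (floorDilutedPercolation 3 (criticalProbI 3) 1) (halfBox r) : ℝ) ≤
          C' * (r : ℝ) ^ ((3 + κ) / (2 - γ₁ / 2)) :=
  Summit.CriticalPhenomena.PercolationContinuityZ3.Theorems.TallClusterMassBound.TightnessLine.stub_crossoverTransfer

/-- **STUB 6 (ENGINE 4; provable now, LANDED by lead c2, p117888) — half-box two-point sum transfer.** A power bound
`Σ_{x,y ∈ Λ_r} P_{p_c}(x ↔_ℍ y) ≤ C r^t` (all `r ≥ 1`, `t ≥ 0`) gives `typicalMax PcH (halfBox r) ≤ C' r^{t/2}`: second moment of the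
maximal trace `(M-1)²/e ≤ Σ_{x,y ∈ Λ_r} PcH(x ↔ y)` (Hutchcroft 2022 Prop. 2.4, tree `sq_typicalMax_le_sum_real_openConn`) and the bridge
`PcH(x ↔ y) ≤ P_{p_c}(x ↔_ℍ y)` for `x ∈ ℍ` (a.s. the open edges of `PcH` lie in `ℍ`). The converse comparison `T(r) ≤ 108 r³ M` is landed
alongside (`halfBoxTwoPointSum_le_typicalMax`). File `Theorems/PercLowPointHalfSpaceTallClusterMassBoundStubBallTwoPointTransfer.lean` (300 lines). -/
theorem stub_halfBoxTwoPointTransfer :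
    ∀ (t C : ℝ), 0 ≤ t →
      (∀ r : ℕ, 1 ≤ r →
        ∑ x ∈ halfBox r, ∑ y ∈ halfBox r, (Pp (criticalProbI 3)).real (openConnIn Hs x y) ≤ C * (r : ℝ) ^ t) →
      ∃ C' : ℝ, ∀ r : ℕ, 1 ≤ r →
        (typicalMax (floorDilutedPercolation 3 (criticalProbI 3) 1) (halfBox r) : ℝ) ≤ C' * (r : ℝ) ^ (t / 2) :=
  Summit.CriticalPhenomena.PercolationContinuityZ3.Theorems.TallClusterMassBound.TightnessLine.stub_halfBoxTwoPointTransfer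

/-- **STUB 7 (ENGINE 4″; provable now, LANDED by lead c2, p118651) — subharmonicity transfer.** Sub-mean-value of `τ_p(0,·)^s` off `Λ_R`
for every `p < p_c(ℤ³)` (`s > 0` fixed) forces `τ_{p_c}(0,x) ≤ C ‖x‖∞^{-1/s}` for `x ≠ 0`: exterior maximum principle on ℤ³ against the lattice
Green function (`exteriorSubharmonic_le_inv_norm`, decay exponent `b = 1`), `τ_p → 0` below `p_c`, undo the power, left-continuity at `p_c`.
File `Theorems/PercLowPointHalfSpaceTallClusterMassBoundStubSubharmonicTransfer.lean` (320 lines). -/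
theorem stub_subharmonicTransfer :
    ∀ {s : ℝ} {R : ℕ}, 0 < s →
      (∀ p : unitInterval, (p : ℝ) < criticalProb (zdGraph 3) (0 : Site 3) →
        ∀ x : Site 3, (R : ℝ) < ‖x‖ →
          tau 3 p 0 x ^ s ≤ (1 / 6 : ℝ) * ∑ i : Fin 3, (tau 3 p 0 (x + Pi.single i 1) ^ s + tau 3 p 0 (x - Pi.single i 1) ^ s)) →
      ∃ C : ℝ, 0 < C ∧ ∀ x : Site 3, x ≠ 0 → tau 3 (criticalProbI 3) 0 x ≤ C * ‖x‖ ^ (-(1 / s)) :=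
  Summit.CriticalPhenomena.PercolationContinuityZ3.Theorems.TallClusterMassBound.TightnessLine.tau_criticalProbI_le_of_subharmonicPower

/-! ## Composition (all proved) -/

/-- **COMPOSITION (kernel-checked modulo the stubs): ARROW 1 (stubs 1a, 1b) and C⁺ (stub 2) imply the crux
`TallClusterMassBound`, concluded BY NAME.** [folklore] -/
theorem TallClusterMassBound_of : TallClusterMassBound := by
  obtain ⟨K, hK⟩ := stub_massLeTypicalMaxLog
  obtain ⟨s, hs, C, hC⟩ := stub_halfBoxTypicalMax
  exact tallClusterMassBound_iff.2 (stub_tightnessArithmetic K s C hs hK hC)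

/-- ENGINE COMPOSITION 1: a bulk critical volume tail with exponent `θ > 1/11` ("`δ < 11`") gives `MassBoundAt p_c (11/4)`
(stubs 1a, 1b, 3; bookkeeping `3/(1+θ) < 11/4 ⟺ θ > 1/11`). [folklore] -/
theorem massBoundAt_of_volumeTail {θ C : ℝ} (hθ : (1 : ℝ) / 11 < θ) (hθ1 : θ ≤ 1)
    (hV : ∀ n : ℕ, 1 ≤ n → (Pp (criticalProbI 3)).real (clusterSizeGe (0 : V3) n) ≤ C * (n : ℝ) ^ (-θ)) :
    MassBoundAt (criticalProbI 3) ((11 : ℝ) / 4) := by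
  have hθpos : 0 < θ := by linarith
  obtain ⟨C', hC'⟩ := stub_firstMomentTransfer θ C hθpos hθ1 hV
  obtain ⟨K, hK⟩ := stub_massLeTypicalMaxLog
  refine stub_tightnessArithmetic K (3 / (1 + θ)) C' ?_ hK hC'
  have hden : 0 < 1 + θ := by linarith
  rw [div_lt_div_iff₀ hden (by norm_num : (0 : ℝ) < 4)]
  nlinarith

/-- ENGINE COMPOSITION 2: a subcritical susceptibility bound `χ(p) ≤ C (p_c-p)^{-γ}` with `1 ≤ γ < 20/11` gives
`MassBoundAt p_c (11/4)` (stubs 1a, 1b, 3, 4; `θ = 1 - γ/2 > 1/11 ⟺ γ < 20/11`). [folklore] -/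
theorem massBoundAt_of_subcritGamma {γ C : ℝ} (hγ1 : 1 ≤ γ) (hγ : γ < (20 : ℝ) / 11)
    (hS : ∀ p : unitInterval, (p : ℝ) < criticalProb (zdGraph 3) (0 : V3) →
      chi 3 p ≤ C * (criticalProb (zdGraph 3) (0 : V3) - (p : ℝ)) ^ (-γ)) :
    MassBoundAt (criticalProbI 3) ((11 : ℝ) / 4) := by
  have hγ2 : γ < 2 := by linarith
  obtain ⟨C', hC'⟩ := stub_klVolumeTail γ C hγ1 hγ2 hS
  exact massBoundAt_of_volumeTail (θ := 1 - γ / 2) (by linarith) (by linarith) hC'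

/-- ENGINE COMPOSITION 3: a subcritical surface susceptibility profile bound with `1 ≤ γ₁`, `0 ≤ κ`, `11γ₁ + 8κ < 20` gives
`MassBoundAt p_c (11/4)` (stubs 1a, 1b, 5; `(3+κ)/(2-γ₁/2) < 11/4 ⟺ 11γ₁ + 8κ < 20`). [folklore] -/
theorem massBoundAt_of_surfaceCrossover {γ₁ κ C : ℝ} (hγ : 1 ≤ γ₁) (hκ : 0 ≤ κ) (hlin : 11 * γ₁ + 8 * κ < 20)
    (hS : ∀ p : unitInterval, (p : ℝ) < criticalProb (zdGraph 3) (0 : V3) → ∀ h R : ℕ,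
      ∑ x ∈ box 3 R, (Pp p).real (openConnIn Hs (up h) x) ≤
        C * (criticalProb (zdGraph 3) (0 : V3) - (p : ℝ)) ^ (-γ₁) * ((h : ℝ) + 1) ^ κ) :
    MassBoundAt (criticalProbI 3) ((11 : ℝ) / 4) := by
  have hγ2 : γ₁ < 2 := by nlinarith
  obtain ⟨C', hC'⟩ := stub_crossoverTransfer γ₁ κ C hγ hγ2 hκ hS
  obtain ⟨K, hK⟩ := stub_massLeTypicalMaxLog
  refine stub_tightnessArithmetic K ((3 + κ) / (2 - γ₁ / 2)) C' ?_ hK hC'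
  have hden : 0 < 2 - γ₁ / 2 := by linarith
  rw [div_lt_div_iff₀ hden (by norm_num : (0 : ℝ) < 4)]
  nlinarith

/-- ENGINE COMPOSITION 4: a power bound `t < 11/2` on the half-box two-point sum `Σ_{x,y ∈ Λ_r} P_{p_c}(x ↔_ℍ y) ≤ C r^t` gives
`MassBoundAt p_c (11/4)` (stubs 1a, 1b, 6; `t` raised to `max t 0`; `(max t 0)/2 < 11/4`). [folklore] -/
theorem massBoundAt_of_halfBoxTwoPointSum {t C : ℝ} (ht : t < (11 : ℝ) / 2)
    (hT : ∀ r : ℕ, 1 ≤ r →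
      ∑ x ∈ halfBox r, ∑ y ∈ halfBox r, (Pp (criticalProbI 3)).real (openConnIn Hs x y) ≤ C * (r : ℝ) ^ t) :
    MassBoundAt (criticalProbI 3) ((11 : ℝ) / 4) := by
  have hT' : ∀ r : ℕ, 1 ≤ r →
      ∑ x ∈ halfBox r, ∑ y ∈ halfBox r, (Pp (criticalProbI 3)).real (openConnIn Hs x y) ≤
        max C 0 * (r : ℝ) ^ (max t 0) := by
    intro r hr
    have hr' : (1 : ℝ) ≤ r := by exact_mod_cast hr
    refine (hT r hr).trans ?_
    have hpt : 0 ≤ (r : ℝ) ^ t := Real.rpow_nonneg (by linarith) _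
    calc C * (r : ℝ) ^ t ≤ max C 0 * (r : ℝ) ^ t := mul_le_mul_of_nonneg_right (le_max_left _ _) hpt
      _ ≤ max C 0 * (r : ℝ) ^ (max t 0) :=
          mul_le_mul_of_nonneg_left (Real.rpow_le_rpow_of_exponent_le hr' (le_max_left _ _)) (le_max_right _ _)
  obtain ⟨C', hC'⟩ := stub_halfBoxTwoPointTransfer (max t 0) (max C 0) (le_max_right _ _) hT'
  obtain ⟨K, hK⟩ := stub_massLeTypicalMaxLog
  refine stub_tightnessArithmetic K (max t 0 / 2) C' ?_ hK hC'
  have : max t 0 < (11 : ℝ) / 2 := max_lt ht (by norm_num)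
  linarith

/-- ENGINE COMPOSITION 4′ (bulk parent): a ball-summed critical two-point decay `Σ_{z ∈ B_R} τ_{p_c}(0,z) ≤ C R^{3-a}` at any rate
`a > 1/2` gives the crux (landed glue `tallClusterMassBound_of_ballTwoPointDecay`, p117888), read back as `MassBoundAt p_c (11/4)`. [folklore] -/
theorem massBoundAt_of_ballTwoPointDecay {a C : ℝ} (ha : (1 : ℝ) / 2 < a)
    (hS : ∀ R : ℕ, 1 ≤ R → ∑ z ∈ box 3 R, (Pp (criticalProbI 3)).real (openConn 0 z) ≤ C * (R : ℝ) ^ (3 - a)) :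
    MassBoundAt (criticalProbI 3) ((11 : ℝ) / 4) :=
  tallClusterMassBound_iff.1
    (Summit.CriticalPhenomena.PercolationContinuityZ3.Theorems.TallClusterMassBound.TightnessLine.tallClusterMassBound_of_ballTwoPointDecay
      ha hS)

/-- ENGINE COMPOSITION 5: PercSubharmonicSquare's crux K1 (`SubharmonicPower`) at any FIXED exponent `s < 2` gives the crux
(landed glue `tallClusterMassBound_of_subharmonicPower_lt_two`, p118651), read back as `MassBoundAt p_c (11/4)`. [folklore] -/
theorem massBoundAt_of_subharmonicPower_lt_two {s : ℝ} {R : ℕ} (hs : 0 < s) (hs2 : s < 2)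
    (hsub : ∀ p : unitInterval, (p : ℝ) < criticalProb (zdGraph 3) (0 : Site 3) →
      ∀ x : Site 3, (R : ℝ) < ‖x‖ →
        tau 3 p 0 x ^ s ≤ (1 / 6 : ℝ) * ∑ i : Fin 3, (tau 3 p 0 (x + Pi.single i 1) ^ s + tau 3 p 0 (x - Pi.single i 1) ^ s)) :
    MassBoundAt (criticalProbI 3) ((11 : ℝ) / 4) :=
  tallClusterMassBound_iff.1
    (Summit.CriticalPhenomena.PercolationContinuityZ3.Theorems.TallClusterMassBound.TightnessLine.tallClusterMassBound_of_subharmonicPower_lt_two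
      hs hs2 hsub)

/-- ENGINE COMPOSITION 5′: the EXISTING crux `SquareSubharmonic` (stmt-CriticalPhenomena-11506, verbatim) gives `MassBoundAt p_c m` for every
`m > 11/4` — the crux up to ARROW 1's `log r` (landed `massBoundAt_of_squareSubharmonic`, p118651). [folklore] -/
theorem massBoundAt_of_squareSubharmonic_gt
    (h : Summit.CriticalPhenomena.PercolationContinuityZ3.Theses.PercSubharmonicSquare.SquareSubharmonic) {m : ℝ} (hm : (11 : ℝ) / 4 < m) :
    MassBoundAt (criticalProbI 3) m :=
  Summit.CriticalPhenomena.PercolationContinuityZ3.Theorems.TallClusterMassBound.TightnessLine.massBoundAt_of_squareSubharmonic h m hm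

/-! ## ARROW 1 sharpened (lead c3, LANDED p130529): the logarithm is `log⁺` of ONE first-moment ratio

`Theorems/PercLowPointHalfSpaceTallClusterMassBoundArrowOneLogRatio.lean` keeps the root factor
`q = P^ℍ(|K_0 ∩ Λ_r| ≥ M)` of Hutchcroft's rooted tightness that ARROW 1 bounded by `1`:
`M_p(r) ≤ (2+3e^{3/2}) · M · π · (1 + log⁺(q/π))` (`mass_le_typicalMax_mul_log_ratio`, every `p`) and, by Markov
`M q ≤ E^ℍ|K_0 ∩ Λ_r| ≤ χ_ℍ^{(r)}`, `M_p(r) ≤ (2+3e^{3/2}) · M · π · (1 + log⁺ W_p(r))` with the `ℍ`-native FIRST-MOMENT RATIO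
`W_p(r) := χ_ℍ^{(r)}(p) / (M π)` (`mass_le_typicalMax_mul_log_chiRatio`; `χ_ℍ^{(r)} = chiH p r = Σ_{x ∈ B_r} P_p(0 ↔_ℍ x)`, the truncated
wall susceptibility; Harris–FKG `χ_ℍ π ≤ M_p(r)` gives `W ≳ 1/(2+3e^{3/2})` up to the log, so nothing is lost). Consequently the
exponent loss of ENGINE COMPOSITION 5′ is located in ONE quantity: B ⟸ stmt-11506 ∧ `W_{p_c}` bounded (composition 5″ below), and
C⁺ at EXACTLY `s = 11/4` (not `<`) ∧ `W` bounded ⟹ B (`massBoundAt_of_typicalMax_le_of_chiRatio`). Heuristically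
`χ_ℍ^{(r)} ≍ r^{3-x_s-x_h}` and `M π ≍ r^{d_f - x_s}` have EQUAL exponents iff `x_h = 3 - d_f` (wall hyperscaling), so `W ≍ 1` in the
real world; but `W` bounded is a regularity/hyperscaling-class statement (it fails in a world where `π_s` drops abruptly between
`r/2` and `r`, where B itself need not fail), it is NOT an existing item, and the companion negative lemma (other helper file,
`not_massLeTypicalMax_logfree_of_lt_criticalProb`) shows the log-free ARROW 1 is FALSE for every `0 < p < p_c` (`M ≲ (log r)³`
by sharpness while `M_p(r) ≥ (r+1)π`): the log cannot be removed by any argument uniform in `p`. -/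

/-- **STUB 8 (ARROW 1 sharpened; LANDED by lead c3, p130529)** — `typicalMax ≤ C r^s` at EXACTLY the exponent `s` plus a bounded
wall first-moment ratio `χ_ℍ^{(r)} ≤ K · M · π` give `MassBoundAt p_c s` with no loss. [folklore] -/
theorem stub_massBoundAt_of_typicalMax_le_of_chiRatio :
    ∀ (s C K : ℝ), (∀ r : ℕ, 1 ≤ r → (typicalMax (floorDilutedPercolation 3 (criticalProbI 3) 1) (halfBox r) : ℝ) ≤ C * (r : ℝ) ^ s) →
      (∀ r : ℕ, 1 ≤ r → chiH (criticalProbI 3) r ≤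
        K * (typicalMax (floorDilutedPercolation 3 (criticalProbI 3) 1) (halfBox r) : ℝ) * armProb (criticalProbI 3) r) →
      MassBoundAt (criticalProbI 3) s :=
  Summit.CriticalPhenomena.PercolationContinuityZ3.Theorems.TallClusterMassBound.TightnessLine.massBoundAt_of_typicalMax_le_of_chiRatio

/-- ENGINE COMPOSITION 5″ (lead c3, p130529): the EXISTING crux `SquareSubharmonic` (stmt-CriticalPhenomena-11506, verbatim) together with a
bounded wall first-moment ratio `χ_ℍ^{(r)}(p_c) ≤ K · typicalMax P^ℍ_{p_c} Λ_r · π_s(r)` gives the crux (landed `tallClusterMassBound_of_squareSubharmonic_of_chiRatio`), read back as `MassBoundAt p_c (11/4)` —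
B at `m = 11/4` exactly, the `log r` of composition 5′ removed by the ratio hypothesis. [folklore] -/
theorem massBoundAt_of_squareSubharmonic_of_chiRatio
    (h : Summit.CriticalPhenomena.PercolationContinuityZ3.Theses.PercSubharmonicSquare.SquareSubharmonic)
    (hW : ∃ K : ℝ, ∀ r : ℕ, 1 ≤ r → chiH (criticalProbI 3) r ≤
      K * (typicalMax (floorDilutedPercolation 3 (criticalProbI 3) 1) (halfBox r) : ℝ) * armProb (criticalProbI 3) r) :
    MassBoundAt (criticalProbI 3) ((11 : ℝ) / 4) :=
  tallClusterMassBound_iff.1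
    (Summit.CriticalPhenomena.PercolationContinuityZ3.Theorems.TallClusterMassBound.TightnessLine.tallClusterMassBound_of_squareSubharmonic_of_chiRatio
      h hW)

/-- **STUB 9 (ARROW 1 sharpened, canonical form; LANDED by lead c3, p130878)** — `typicalMax ≤ C r^s` at EXACTLY `s` plus a bounded
ROOT RATIO `q(r) = P^ℍ_{p_c}(|K_0 ∩ Λ_r| ≥ typicalMax) ≤ K π_s(r)` give `MassBoundAt p_c s` with no loss. [folklore] -/
theorem stub_massBoundAt_of_typicalMax_le_of_rootRatio :
    ∀ (s C K : ℝ), (∀ r : ℕ, 1 ≤ r → (typicalMax (floorDilutedPercolation 3 (criticalProbI 3) 1) (halfBox r) : ℝ) ≤ C * (r : ℝ) ^ s) →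
      (∀ r : ℕ, 1 ≤ r → (floorDilutedPercolation 3 (criticalProbI 3) 1).real
        {ω | typicalMax (floorDilutedPercolation 3 (criticalProbI 3) 1) (halfBox r) ≤ clusterCapIn (halfBox r) ω 0} ≤
          K * armProb (criticalProbI 3) r) →
      MassBoundAt (criticalProbI 3) s :=
  Summit.CriticalPhenomena.PercolationContinuityZ3.Theorems.TallClusterMassBound.TightnessLine.massBoundAt_of_typicalMax_le_of_rootRatio

/-- ENGINE COMPOSITION 5‴ (lead c3, p130878): the EXISTING crux `SquareSubharmonic` (stmt-CriticalPhenomena-11506, verbatim) together with a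
bounded VOLUME-VERSUS-RADIUS ratio of the wall cluster, `P^ℍ_{p_c}(|C_ℍ(0)| ≥ typicalMax P^ℍ_{p_c} Λ_r) ≤ K · π_s(r)` (one direction of wall
hyperscaling; weaker than the `χ`-ratio of 5″ by Markov), gives the crux (landed `tallClusterMassBound_of_squareSubharmonic_of_volRad`), read back as
`MassBoundAt p_c (11/4)`. [folklore] -/
theorem massBoundAt_of_squareSubharmonic_of_volRad
    (h : Summit.CriticalPhenomena.PercolationContinuityZ3.Theses.PercSubharmonicSquare.SquareSubharmonic)
    (hV : ∃ K : ℝ, ∀ r : ℕ, 1 ≤ r → (floorDilutedPercolation 3 (criticalProbI 3) 1).real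
      (clusterSizeGe (0 : V3) (typicalMax (floorDilutedPercolation 3 (criticalProbI 3) 1) (halfBox r))) ≤
        K * armProb (criticalProbI 3) r) :
    MassBoundAt (criticalProbI 3) ((11 : ℝ) / 4) :=
  tallClusterMassBound_iff.1
    (Summit.CriticalPhenomena.PercolationContinuityZ3.Theorems.TallClusterMassBound.TightnessLine.tallClusterMassBound_of_squareSubharmonic_of_volRad
      h hV)

/-- **STUB 10 (ARROW 1 at an arbitrary threshold; LANDED by lead c3, p135322)** — for every `p`, `r` and every integer `t ≥ typicalMax P^ℍ_p Λ_r`: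
`M_p(r) ≤ (2+3e^{3/2}) · t · π_p(r) · (1 + log⁺(q_t/π_p(r)))`, `q_t = P^ℍ_p(|K_0 ∩ Λ_r| ≥ t)` (rooted sub-multiplicativity at threshold `t`,
`P(|K_max(Λ_r)| ≥ t) ≤ 1/e`). [folklore] -/
theorem stub_mass_le_threshold_mul_log_ratio :
    ∀ (p : unitInterval) (r t : ℕ), typicalMax (floorDilutedPercolation 3 p 1) (halfBox r) ≤ t →
      mass p r ≤ (2 + 3 * Real.exp (3 / 2)) * (t : ℝ) * armProb p r *
        (1 + max 0 (Real.log ((floorDilutedPercolation 3 p 1).real {ω | t ≤ clusterCapIn (halfBox r) ω 0} / armProb p r))) :=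
  Summit.CriticalPhenomena.PercolationContinuityZ3.Theorems.TallClusterMassBound.TightnessLine.mass_le_threshold_mul_log_ratio

/-- ENGINE COMPOSITION 5⁗ (lead c3, p135322): the EXISTING crux `SquareSubharmonic` (stmt-CriticalPhenomena-11506, verbatim) together with the typicalMax-FREE
wall volume-versus-radius inequality `WVR := ∀ c > 0, ∃ K, ∀ r ≥ 1, P^ℍ_{p_c}(|C_ℍ(0)| ≥ ⌈c r^{11/4}⌉) ≤ K · π_s(r)` gives the crux BY NAME at `m = 11/4`
(stub 10 at `t_r = ⌈c₀ r^{11/4}⌉ ≥ typicalMax`). `WVR` is weaker than `V`-bounded given 11506, but exponent-laden by itself (heuristically `⟺ d_f ≤ 11/4`). [folklore] -/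
theorem massBoundAt_of_squareSubharmonic_of_wallVolRad
    (h : Summit.CriticalPhenomena.PercolationContinuityZ3.Theses.PercSubharmonicSquare.SquareSubharmonic)
    (hW : ∀ c : ℝ, 0 < c → ∃ K : ℝ, ∀ r : ℕ, 1 ≤ r → (floorDilutedPercolation 3 (criticalProbI 3) 1).real
      (clusterSizeGe (0 : V3) ⌈c * (r : ℝ) ^ ((11 : ℝ) / 4)⌉₊) ≤ K * armProb (criticalProbI 3) r) :
    MassBoundAt (criticalProbI 3) ((11 : ℝ) / 4) :=
  tallClusterMassBound_iff.1
    (Summit.CriticalPhenomena.PercolationContinuityZ3.Theorems.TallClusterMassBound.TightnessLine.tallClusterMassBound_of_squareSubharmonic_of_wallVolRad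
      h hW)

/-- **NEGATIVE (lead c3, LANDED p130858): ARROW 1's logarithm is necessary uniformly in `p`.** For every `0 < p < p_c(ℤ³)` the
log-free ARROW 1 `M_p(r) ≤ K · typicalMax P^ℍ_p Λ_r · π_p(r)` (`r ≥ 1`) is FALSE (`typicalMax ≲ (log r)³` by sharpness, while
`M_p(r) ≥ (r+1) π_p(r) > 0`). Hence the root/volume ratio of stubs 8–9 can only be bounded AT `p_c`, by a critical input. [folklore] -/
theorem arrowOne_logfree_false_below_criticalProb :
    ∀ (p : unitInterval), 0 < (p : ℝ) → (p : ℝ) < criticalProb (zdGraph 3) (0 : V3) →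
      ¬ ∃ K : ℝ, ∀ r : ℕ, 1 ≤ r →
        mass p r ≤ K * (typicalMax (floorDilutedPercolation 3 p 1) (halfBox r) : ℝ) * armProb p r :=
  Summit.CriticalPhenomena.PercolationContinuityZ3.Theorems.TallClusterMassBound.TightnessLine.not_massLeTypicalMax_logfree_of_lt_criticalProb

/-! ## Lead c4 (2026-08-17): the relaxed form `B_all` and the BYPASS of B inside the route (LANDED p136101, p136366)

`Theorems/PercLowPointHalfSpaceTallClusterMassBoundRestatement.lean`: `B_all := ∀ m > 11/4, …` in ROUTE vocabulary ⟸ stmt-11506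
(`Restatement.tallClusterMassBoundAll_of_squareSubharmonic`), B ⟹ `B_all`, `K_all ⟹ K`, and the deciding theorem verbatim with `B_all`.
`Theorems/PercLowPointHalfSpaceTallClusterMassBoundBypass.lean`: stmt-11506 ⟹ half-box susceptibility `≤ C n^{5/2}` ⟹ crux K's live-line
hypothesis-stub B♯ (`stub_noFatHalfBoxOrigin` of stmt-14713 = this line's C⁺ AT the exponent `11/4`) verbatim; composed with the floor-russo glue,
`SquareSubharmonic ∧ A♯ₛ ⟹ PercolationContinuityZ3` (consistency only: 11506 alone closes the conjunct through route PercSubharmonicSquare).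
Informative: K's live line consumes B♯, not B; B♯, `B_all`, C⁺-at-`11/4` are all consequences of the existing crux 11506.
Verdict of lead c4: B is mis-pinned at `m = 11/4` (dossier `Lines/SketchIdeator4-verdict-c4.md`); the one open stub above stays open (crux-sized). -/

/-- **STUB 11 (lead c4, LANDED p136101)** — the relaxed crux `∀ m > 11/4, MassBoundAt p_c m`, in route vocabulary, from the EXISTING crux
`SquareSubharmonic` (stmt-CriticalPhenomena-11506). [folklore] -/
theorem restated_tallClusterMassBoundAll_of_squareSubharmonic
    (h : Summit.CriticalPhenomena.PercolationContinuityZ3.Theses.PercSubharmonicSquare.SquareSubharmonic) {m : ℝ} (hm : (11 : ℝ) / 4 < m) :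
    MassBoundAt (criticalProbI 3) m :=
  Summit.CriticalPhenomena.PercolationContinuityZ3.Theorems.TallClusterMassBound.Restatement.tallClusterMassBoundAll_of_squareSubharmonic h m hm

/-- **STUB 12 (lead c4, LANDED p136366):** `SquareSubharmonic` (stmt-11506) and the sharp floor two-arm bound A♯ₛ
(`stub_twoArmSharpFloorE1` of crux K's line, stmt-14713) give `θ(p_c(ℤ³)) = 0` through K's line with B♯ ⟸ 11506; crux B is not used
(consistency statement: 11506 alone closes the conjunct via route PercSubharmonicSquare). [folklore] -/
theorem bypass_percolationContinuityZ3_of_squareSubharmonic_of_twoArmSharpFloorE1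
    (h : Summit.CriticalPhenomena.PercolationContinuityZ3.Theses.PercSubharmonicSquare.SquareSubharmonic)
    (hA : ∃ κ C : ℝ, 0 < κ ∧ ∀ s : unitInterval, ∀ r : ℕ, 1 ≤ r →
      (floorDilutedPercolation 3 (criticalProbI 3) s).real
        ({ω | ∃ y : Site 3, (∃ i : Fin 3, ((r : ℕ) : ℤ) ≤ |y i|) ∧ ω ∈ openConnIn {x : Site 3 | 0 ≤ x 0} 0 y} ∩
          {ω | ∃ y : Site 3, (∃ i : Fin 3, ((r : ℕ) : ℤ) ≤ |y i - (Pi.single 1 1 : Site 3) i|) ∧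
            ω ∈ openConnIn {x : Site 3 | 0 ≤ x 0} (Pi.single 1 1) y} ∩
          (openConnIn {x : Site 3 | 0 ≤ x 0} 0 (Pi.single 1 1))ᶜ) ≤ C * (r : ℝ) ^ (-(11 / 4 + κ))) :
    _root_.PercolationContinuityZ3 :=
  Summit.CriticalPhenomena.PercolationContinuityZ3.Theorems.TallClusterMassBound.Restatement.percolationContinuityZ3_of_squareSubharmonic_of_twoArmSharpFloorE1
    h hA

end Summit.CriticalPhenomena.PercolationContinuityZ3.Cruxes.TallClusterMassBound.TightnessLine
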